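import Summits.HodgeConjecture.HodgeConjecture.Theorems.SixfoldTableXCensusSexticGeneralRow
import Literature.AlgebraicGeometry.HodgeTheory.CMFieldOneBalancedPlaceHodgeLie
import Literature.AlgebraicGeometry.HodgeTheory.NoWeilTypeHodgeTraceDictionary
import HarnessLib

/-!
# TABLE X (dimension 6) — row 12 `g6.IV(3,1)` (`End⁰ = F` a SEXTIC CM field), the members of CM PATTERN `(2,2,1)` NOT OF
# WEIL TYPE: the census nodes X2 / X1 on the whole isogeny class, L15's Lie hypothesis `hU` REDUCED IN THE KERNEL to the
# geometric no-Weil-type condition `hnW` (displayed) by the tree's one-balanced-place Lie theorem and the no-Weil-type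
# dictionary (Moonen–Zarhin 1999 (2.3); Ribet 1983 Thm. 0; van Geemen 1994 §2.4) — cell `pub-hodgeav-hg6`, req-37 (A) Q2b, eng-5 g6

HONEST FRAMING. HC, `HC_AV` (stmt-1333), `HC_CM` (stmt-3052) and the rung H2 are NOT proved and do not occur here. The
census nodes `TableX.SixfoldCodimTwoCensus` (X2) / `TableX.SixfoldCodimThreeCensus` (X1) of `SixfoldTableXCover` are OURS
(`@[conjecture]`), never asserted — they quantify over ALL off-residue sixfolds; here they are DERIVED on one isogeny
class per hypothesis set, UNDER ONE DISPLAYED GEOMETRIC HYPOTHESIS `hnW`. KERNEL ONLY: theorems over existing declarations;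
no definition, no `sorry`, no named fact, no displayed Lie hypothesis; typed ≠ proved.

WHY THIS MODULE (census-node self-audit, axis A7 «a row VERIFIED in the kernel, not by dossier», continued). L15
(`SixfoldTableXCensusSexticGeneralRow`, eng-4 g5) put row 12 on A7 for the GENERAL member with the Lie hypothesis `hU`
(«every `(φ^*)_ℂ`-commuting `ψ_ℂ`-skew operator of `H¹(B(ℂ); ℂ)` lies in `Lie Hg(H¹(B)) ⊗ ℂ`», i.e. `Hg(B) = U_F(V,ψ)`)
DISPLAYED; the companion module `SixfoldTableXCensusSexticOneScalarAllMembers` DISCHARGED `hU` for the CM pattern `(2,1,1)`.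
For the CM PATTERN `(2,2,1)` — ONE balanced place `k₀` (both `eigenMultiplicity B φ (μ k₀)`, `eigenMultiplicity B φ (conj μ k₀)`
non-zero) and the two other places `Θ`-scalar — `Hg(B) = U_F` is NOT true for all members: it fails exactly for the members
of WEIL TYPE, `F ⊇ k = ℚ(β)` imaginary quadratic (`β ∈ End(B)`, `β ∘ β = −d`) acting on `H^{1,0}(B)` with multiplicities
`(3,3)` (then `Hg(B) ⊆ SU_k`-type). The cell's U-programme (eng-5 g6: socket `CMThetaSocket.*`, centre
`CMThetaCentre.centre_of_pair`, derived algebra `CMDerived.*`, no-twist `CMNoTwist.lift_of_unique_balanced`, irreducibility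
`CMIrred.*`, assembly `CMThetaOneBalanced.*`, Hodge adapter `AbelianVariety.hodgeLieC_of_cmField_oneBalancedPlace`,
no-Weil-type dictionary `AbelianVariety.trace_mul_theta_ne_zero_of_noWeilType`) PROVES `hU` for every SIMPLE `B` with
`dim_ℚ End⁰(B) = 6`, `φ ∈ End(B)` with six pairwise non-conjugate eigenvalues of pair multiplicity `2`, CM pattern `(2,2,1)`,
UNDER the geometric no-Weil-type condition `hnW`: «for every `d > 0` and every `β ∈ End(B)` with `β ≫ β = −(d • 𝟙 B)`,
`eigenMultiplicity B β (i√d) ≠ eigenMultiplicity B β (−i√d)`» (B is not of Weil type relative to any imaginary quadratic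
`ℚ(β) ⊂ End⁰(B)`, van Geemen 1994 §2.4; vacuous when `F` has no imaginary quadratic subfield). THIS FILE is L15's §1–§2
with `hU` REPLACED by the pattern data and `hnW` — nothing of L15 / L10 / G3 is restated, only applied:
* §1 `census_of_isIsogenous_cmField_oneBalancedPlace` — both census conclusions X2-at-`A`, X1-at-`A` at every `A ∼ B`
  (any `ι` with `|ι| ≤ 3`, `dim B = 2|ι|`), under `hnW`; `hodgeConjectureFor_of_isIsogenous_cmField_oneBalancedPlace` —
  L6's CONCLUSION `HodgeConjectureFor` on the whole isogeny class, under `hnW`.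
* §2 `census_row12_sextic_oneBalancedPlace` — TABLE X row 12, PATTERN `(2,2,1)`, ALL MEMBERS NOT OF WEIL TYPE, KERNEL
  VERDICT under `hnW`: every `A ∼ B` is IN THE NODES' DOMAIN (`dim A = 6 ∧ ¬ 𝒞 A`: L15's hU-free half, unconditional)
  AND satisfies X2-at-`A` ∧ X1-at-`A`; `census_row12_sextic_oneBalancedPlace_self`.

READING (honest scope). `hnW` is DISPLAYED, never discharged: it is a condition on (the isogeny class of) `B` — the
Weil-type members of pattern `(2,2,1)` are exactly the ones it excludes, and for them `hU` is FALSE, so no `hU`-route covers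
them (they belong to the R-W6 / Weil-class node `weilClassesOf`). With `hnW`, patterns `(2,1,1)` (companion module,
unconditional) and `(2,2,1)` (this file) of row 12 are on A7; pattern `(1,1,1)` (`Hg ⊆ SU_F`, `hU` FALSE — outside this
route) and the CM / non-simple types are not. HC / HC_AV are NOT proved beyond these statements' own content; X2 / X1 stay
`@[conjecture]` globally. No inhabitant is exhibited and none is invented here.

All declarations live in the sub-namespace `TableX.TypeIVRows` (lead g2 DEDUP RULE: import the entry points, restate
nothing). Nothing here is a corollary of `HC_CM`; typed ≠ proved.
-/

set_option linter.dupNamespace false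

noncomputable section

open scoped TensorProduct
open CategoryTheory
open Literature.AlgebraicGeometry Literature.AlgebraicGeometry.Motives
open Literature.AlgebraicGeometry.Motives.AbelianVariety (IsIsogenous IsSimple)
open Literature.AlgebraicGeometry.HodgeTheory
open Literature.AlgebraicGeometry.Milne1999
open Literature.AlgebraicTopology.SingularHomology
open Literature.Barriers.HodgeConjecture
open Summit.HodgeConjecture.HodgeConjecture.Ring2.ClassTargets
open Summit.HodgeConjecture.HodgeConjecture.Ring2.Motiv (ProdCMCell)
open Summit.HodgeConjecture.HodgeConjecture.Ring2.Atlas (IsQuarticFieldTypeIVFourfold)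
open Summit.HodgeConjecture.HodgeConjecture.TableX.SimpleRows

namespace Summit.HodgeConjecture.HodgeConjecture.TableX.TypeIVRows

/-! ## §1 CM field of degree `2|ι| ≤ 6`, multiplicity `2`, one balanced place, not of Weil type: both census conclusions and
`HodgeConjectureFor` on the isogeny class, `hU` reduced to the displayed geometric `hnW` -/

/-- **Both census conclusions X2-at-`A`, X1-at-`A` at every `A` isogenous to a SIMPLE complex abelian variety `B` with
`dim_ℚ End⁰(B) = 2|ι|` (`|ι| ≤ 3`), `φ ∈ End(B)` with colours `μ : ι → ℂ` of pair multiplicity `2`, `dim B = 2|ι|`, CM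
pattern with ONE balanced place `k₀` and the other places `k₁ ≠ k₂` `Θ`-scalar, `B` NOT OF WEIL TYPE relative to any
`β ∈ End(B)` with `β ≫ β = −d`, `d > 0` (the displayed `hnW`)** — L15's `census_of_isIsogenous_cmFieldGeneral` with its
displayed Lie hypothesis `hU` supplied by `AbelianVariety.hodgeLieC_of_cmField_oneBalancedPlace` and the dictionary
`AbelianVariety.trace_mul_theta_ne_zero_of_noWeilType` (the polarization of `H¹(B(ℂ); ℚ)` and the Betti-universe facts
supplied by the tree's `smoothProjective_hodgeStructure_isPolarizable_holds`, `exists_isReal_hodgeModel_holds`,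
`hodgePQ_independent_of_hodgeModel_holds`). `hnW` is displayed, never discharged. HC ∕ HC_AV NOT proved; X2 ∕ X1 stay
`@[conjecture]` globally.
[cite: MoonenZarhin1999LowDim, §1 (1.8), §2 (2.3)] [cite: Ribet1983, Thm. 0] [cite: vanGeemen1994HodgeAV, §2.4 and Lemma 3.7]
[cite: MumfordAV1970, §19 Cor. 2 of Thm. 1 (p. 174)] -/
theorem census_of_isIsogenous_cmField_oneBalancedPlace {ι : Type} [Fintype ι] [DecidableEq ι] (hι : Fintype.card ι ≤ 3)
    {A B : AbelianVariety ℂ} (hBs : B.IsSimple) (φ : B ⟶ B)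
    (hE : Module.finrank ℚ B.endAlgebra = 2 * Fintype.card ι) (μ : ι → ℂ) (hinj : Function.Injective μ)
    (hdist : ∀ k k', μ k' ≠ starRingEnd ℂ (μ k))
    (hmult : ∀ k, eigenMultiplicity B φ (μ k) + eigenMultiplicity B φ (starRingEnd ℂ (μ k)) = 2)
    (hdim : B.dim = Fintype.card ι * 2) (k₀ : ι)
    (hk₀ : eigenMultiplicity B φ (μ k₀) ≠ 0 ∧ eigenMultiplicity B φ (starRingEnd ℂ (μ k₀)) ≠ 0)
    (hunb : ∀ k, k ≠ k₀ → eigenMultiplicity B φ (μ k) = 0 ∨ eigenMultiplicity B φ (starRingEnd ℂ (μ k)) = 0)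
    (k₁ k₂ : ι) (hk₁₂ : k₁ ≠ k₂) (hk₁ : k₁ ≠ k₀) (hk₂ : k₂ ≠ k₀)
    (hnW : ∀ (d : ℕ) (β : B ⟶ B), 0 < d → β ≫ β = -(d • 𝟙 B) →
      eigenMultiplicity B β (Complex.I * (Real.sqrt d : ℂ)) ≠ eigenMultiplicity B β (-(Complex.I * (Real.sqrt d : ℂ))))
    (hAB : IsIsogenous A B) :
    (∀ c : complexBetti A.X (2 * 2), IsRationalClass c → IsOfHodgeType A.dim A.X (2 * 2) 2 2 c →
      c ∈ divisorClassesSpan A.X A.dim 2 ⊔ Submodule.span ℂ {w' : complexBetti A.X (2 * 2) |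
        ∃ (C : AbelianVariety ℂ) (g : A.X ⟶ C.X) (w : complexBetti C.X (2 * 2)), C.dim < A.dim ∧
          IsRationalClass w ∧ IsOfHodgeType C.dim C.X (2 * 2) 2 2 w ∧ w' = complexBetti.map g (2 * 2) w}) ∧
    (∀ c : complexBetti A.X (2 * 3), IsRationalClass c → IsOfHodgeType A.dim A.X (2 * 3) 3 3 c →
      c ∈ divisorClassesSpan A.X A.dim 3 ⊔ Submodule.span ℂ {w' : complexBetti A.X (2 * 3) |
          ∃ (a : complexBetti A.X (2 * 2)) (b : complexBetti A.X (2 * 1)),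
            IsRationalClass a ∧ IsOfHodgeType A.dim A.X (2 * 2) 2 2 a ∧ IsRationalClass b ∧
            IsOfHodgeType A.dim A.X (2 * 1) 1 1 b ∧ w' = cupProduct (two_mul_add_two_mul 2 1) a b} ⊔
        Submodule.span ℂ {w' : complexBetti A.X (2 * 3) |
          ∃ (C : AbelianVariety ℂ) (g : A.X ⟶ C.X) (w : complexBetti C.X (2 * 3)), C.dim < A.dim ∧
            IsRationalClass w ∧ IsOfHodgeType C.dim C.X (2 * 3) 3 3 w ∧ w' = complexBetti.map g (2 * 3) w} ⊔
        Submodule.span ℂ {w' : complexBetti A.X (2 * 3) |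
          ∃ (B' : AbelianVariety ℂ) (g : A.X ⟶ B'.X) (d : ℕ) (ψ : B' ⟶ B') (w : complexBetti B'.X (2 * 3)),
            B'.dim = 6 ∧ 0 < d ∧ ψ ≫ ψ = -(d • 𝟙 B') ∧ IsRationalClass w ∧
            IsOfHodgeType B'.dim B'.X (2 * 3) 3 3 w ∧ w ∈ weilClassesOf B' ψ 3 d ∧
            w' = complexBetti.map g (2 * 3) w}) := by
  have hHD : exists_isReal_hodgeModel := exists_isReal_hodgeModel_holds
  have hI : hodgePQ_independent_of_hodgeModel := hodgePQ_independent_of_hodgeModel_holds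
  haveI : HodgeTensorFacts.{0, 0} := hodgeTensorFacts_holds.{0, 0}
  have hX : IsSmoothProjective B.dim B.X := AbelianVariety.isSmoothProjective_holds
  obtain ⟨ψ⟩ : (BettiUniverse.hodge hHD (AbelianVariety.isSmoothProjective_holds (A := B)) 1).IsPolarizable :=
    smoothProjective_hodgeStructure_isPolarizable_holds hX (BettiUniverse.realHodgeModel hHD hX)
      (BettiUniverse.realHodgeModel_isHodgeSymmetric hHD hX) 1
  exact census_of_isIsogenous_cmFieldGeneral φ hE μ hinj hdist two_pos hmult hdim hHD hI ψ
    (AbelianVariety.hodgeLieC_of_cmField_oneBalancedPlace hι B hBs φ hE μ hinj hdist hmult hdim k₀ hk₀ hunb k₁ k₂ hk₁₂ hk₁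
      hk₂ hHD hI ψ (AbelianVariety.trace_mul_theta_ne_zero_of_noWeilType B hHD hI ψ hnW)) hAB

/-- **L6's CONCLUSION on the isogeny class under the displayed `hnW`: the Hodge conjecture holds for every complex abelian
variety isogenous to a SIMPLE `B` with `dim_ℚ End⁰(B) = 2|ι|` (`|ι| ≤ 3`), `φ ∈ End(B)` of pair multiplicity `2`,
`dim B = 2|ι|`, CM pattern with ONE balanced place, and `B` not of Weil type relative to any `β ∈ End(B)`, `β ≫ β = −d`**
(L15's `hodgeConjectureFor_of_isIsogenous_cmFieldGeneral` with `hU` supplied by `AbelianVariety.hodgeLieC_of_cmField_oneBalancedPlace`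
and `AbelianVariety.trace_mul_theta_ne_zero_of_noWeilType`). `hnW` is displayed, never discharged; none of Markman₄ / Markman₆ /
R-W6 / X2 / X1 / `HC_CM` enters. HC ∕ HC_AV NOT proved beyond this statement's own content.
[cite: MoonenZarhin1999LowDim, §1 (1.7)–(1.8) and §2 (2.3)] [cite: Ribet1983, Thm. 0] [cite: vanGeemen1994HodgeAV, §2.4 and Lemma 3.7] -/
theorem hodgeConjectureFor_of_isIsogenous_cmField_oneBalancedPlace {ι : Type} [Fintype ι] [DecidableEq ι] (hι : Fintype.card ι ≤ 3)
    {A B : AbelianVariety ℂ} (hBs : B.IsSimple) (φ : B ⟶ B)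
    (hE : Module.finrank ℚ B.endAlgebra = 2 * Fintype.card ι) (μ : ι → ℂ) (hinj : Function.Injective μ)
    (hdist : ∀ k k', μ k' ≠ starRingEnd ℂ (μ k))
    (hmult : ∀ k, eigenMultiplicity B φ (μ k) + eigenMultiplicity B φ (starRingEnd ℂ (μ k)) = 2)
    (hdim : B.dim = Fintype.card ι * 2) (k₀ : ι)
    (hk₀ : eigenMultiplicity B φ (μ k₀) ≠ 0 ∧ eigenMultiplicity B φ (starRingEnd ℂ (μ k₀)) ≠ 0)
    (hunb : ∀ k, k ≠ k₀ → eigenMultiplicity B φ (μ k) = 0 ∨ eigenMultiplicity B φ (starRingEnd ℂ (μ k)) = 0)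
    (k₁ k₂ : ι) (hk₁₂ : k₁ ≠ k₂) (hk₁ : k₁ ≠ k₀) (hk₂ : k₂ ≠ k₀)
    (hnW : ∀ (d : ℕ) (β : B ⟶ B), 0 < d → β ≫ β = -(d • 𝟙 B) →
      eigenMultiplicity B β (Complex.I * (Real.sqrt d : ℂ)) ≠ eigenMultiplicity B β (-(Complex.I * (Real.sqrt d : ℂ))))
    (hAB : IsIsogenous A B) : HodgeConjectureFor A.dim A.X := by
  have hHD : exists_isReal_hodgeModel := exists_isReal_hodgeModel_holds
  have hI : hodgePQ_independent_of_hodgeModel := hodgePQ_independent_of_hodgeModel_holds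
  haveI : HodgeTensorFacts.{0, 0} := hodgeTensorFacts_holds.{0, 0}
  have hX : IsSmoothProjective B.dim B.X := AbelianVariety.isSmoothProjective_holds
  obtain ⟨ψ⟩ : (BettiUniverse.hodge hHD (AbelianVariety.isSmoothProjective_holds (A := B)) 1).IsPolarizable :=
    smoothProjective_hodgeStructure_isPolarizable_holds hX (BettiUniverse.realHodgeModel hHD hX)
      (BettiUniverse.realHodgeModel_isHodgeSymmetric hHD hX) 1
  exact hodgeConjectureFor_of_isIsogenous_cmFieldGeneral φ hE μ hinj hdist two_pos hmult hdim hHD hI ψ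
    (AbelianVariety.hodgeLieC_of_cmField_oneBalancedPlace hι B hBs φ hE μ hinj hdist hmult hdim k₀ hk₀ hunb k₁ k₂ hk₁₂ hk₁
      hk₂ hHD hI ψ (AbelianVariety.trace_mul_theta_ne_zero_of_noWeilType B hHD hI ψ hnW)) hAB

/-! ## §2 TABLE X row 12 `g6.IV(3,1)`, CM pattern `(2,2,1)`, ALL MEMBERS not of Weil type: kernel verdict with domain
membership, `hnW` displayed -/

/-- **TABLE X ROW 12 `g6.IV(3,1)`, CM PATTERN `(2,2,1)`, ALL MEMBERS NOT OF WEIL TYPE — KERNEL VERDICT on the whole isogeny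
class under ONE displayed geometric hypothesis `hnW`.** For a SIMPLE complex abelian SIXFOLD `B` with `dim_ℚ End⁰(B) = 6`,
`φ ∈ End(B)` with colours `μ : Fin 3 → ℂ` (injective, none conjugate to another or itself) of pair multiplicity `2` — so
`F = End⁰(B) = ℚ(φ)` is a sextic CM field with `dim_F H¹(B;ℚ) = 2` — and CM PATTERN `(2,2,1)` (one balanced place `k₀`, the
places `k₁ ≠ k₂` `Θ`-scalar), `B` NOT OF WEIL TYPE («for every `d > 0` and `β ∈ End(B)` with `β ≫ β = −(d • 𝟙 B)`,
`eigenMultiplicity B β (i√d) ≠ eigenMultiplicity B β (−i√d)`»), and for every `A` isogenous to `B`: `dim A = 6` and `A` is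
OFF the residue class `𝒞` (L15's hU-free half, unconditional: `B` simple and not of CM type since `dim_ℚ End⁰(B) = 6 < 12`),
AND both census conclusions X2-at-`A`, X1-at-`A` hold (§1 at `ι = Fin 3`). This is L15's `census_row12_sexticGeneral` with
`hU` REDUCED to `hnW` for the pattern `(2,2,1)`; the Weil-type members it excludes have `hU` FALSE and are NOT covered (R-W6
node). HC ∕ HC_AV NOT proved; X2 ∕ X1 stay `@[conjecture]` globally. [cite: MoonenZarhin1999LowDim, §1 (1.8), §2 (2.3) and §5 (5.1)]
[cite: Ribet1983, Thm. 0] [cite: vanGeemen1994HodgeAV, §2.4 and Lemma 3.7] [cite: MumfordAV1970, §19 Cor. 2 of Thm. 1 (p. 174)] [cite: Milne1999, §2 p. 54] -/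
theorem census_row12_sextic_oneBalancedPlace {A B : AbelianVariety ℂ} (hB : B.dim = 6) (hBs : B.IsSimple) (φ : B ⟶ B)
    (hE6 : Module.finrank ℚ B.endAlgebra = 6) (μ : Fin 3 → ℂ) (hinj : Function.Injective μ)
    (hdist : ∀ k k', μ k' ≠ starRingEnd ℂ (μ k))
    (hmult : ∀ k, eigenMultiplicity B φ (μ k) + eigenMultiplicity B φ (starRingEnd ℂ (μ k)) = 2) (k₀ : Fin 3)
    (hk₀ : eigenMultiplicity B φ (μ k₀) ≠ 0 ∧ eigenMultiplicity B φ (starRingEnd ℂ (μ k₀)) ≠ 0)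
    (hunb : ∀ k, k ≠ k₀ → eigenMultiplicity B φ (μ k) = 0 ∨ eigenMultiplicity B φ (starRingEnd ℂ (μ k)) = 0)
    (k₁ k₂ : Fin 3) (hk₁₂ : k₁ ≠ k₂) (hk₁ : k₁ ≠ k₀) (hk₂ : k₂ ≠ k₀)
    (hnW : ∀ (d : ℕ) (β : B ⟶ B), 0 < d → β ≫ β = -(d • 𝟙 B) →
      eigenMultiplicity B β (Complex.I * (Real.sqrt d : ℂ)) ≠ eigenMultiplicity B β (-(Complex.I * (Real.sqrt d : ℂ))))
    (hAB : IsIsogenous A B) :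
    (A.dim = 6 ∧ ¬ (IsOfCMType A ∨ ProdCMCell IsQuarticFieldTypeIVFourfold (fun Z ↦ Z.dim = 2) A)) ∧
    (∀ c : complexBetti A.X (2 * 2), IsRationalClass c → IsOfHodgeType A.dim A.X (2 * 2) 2 2 c →
      c ∈ divisorClassesSpan A.X A.dim 2 ⊔ Submodule.span ℂ {w' : complexBetti A.X (2 * 2) |
        ∃ (C : AbelianVariety ℂ) (g : A.X ⟶ C.X) (w : complexBetti C.X (2 * 2)), C.dim < A.dim ∧
          IsRationalClass w ∧ IsOfHodgeType C.dim C.X (2 * 2) 2 2 w ∧ w' = complexBetti.map g (2 * 2) w}) ∧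
    (∀ c : complexBetti A.X (2 * 3), IsRationalClass c → IsOfHodgeType A.dim A.X (2 * 3) 3 3 c →
      c ∈ divisorClassesSpan A.X A.dim 3 ⊔ Submodule.span ℂ {w' : complexBetti A.X (2 * 3) |
          ∃ (a : complexBetti A.X (2 * 2)) (b : complexBetti A.X (2 * 1)),
            IsRationalClass a ∧ IsOfHodgeType A.dim A.X (2 * 2) 2 2 a ∧ IsRationalClass b ∧
            IsOfHodgeType A.dim A.X (2 * 1) 1 1 b ∧ w' = cupProduct (two_mul_add_two_mul 2 1) a b} ⊔
        Submodule.span ℂ {w' : complexBetti A.X (2 * 3) |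
          ∃ (C : AbelianVariety ℂ) (g : A.X ⟶ C.X) (w : complexBetti C.X (2 * 3)), C.dim < A.dim ∧
            IsRationalClass w ∧ IsOfHodgeType C.dim C.X (2 * 3) 3 3 w ∧ w' = complexBetti.map g (2 * 3) w} ⊔
        Submodule.span ℂ {w' : complexBetti A.X (2 * 3) |
          ∃ (B' : AbelianVariety ℂ) (g : A.X ⟶ B'.X) (d : ℕ) (ψ : B' ⟶ B') (w : complexBetti B'.X (2 * 3)),
            B'.dim = 6 ∧ 0 < d ∧ ψ ≫ ψ = -(d • 𝟙 B') ∧ IsRationalClass w ∧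
            IsOfHodgeType B'.dim B'.X (2 * 3) 3 3 w ∧ w ∈ weilClassesOf B' ψ 3 d ∧
            w' = complexBetti.map g (2 * 3) w}) :=
  ⟨offResidueSix_of_isIsogenous_of_isSimple_of_not_isOfCMType hAB hB hBs
      (not_isOfCMType_of_finrank_endAlgebra_lt_two_mul_dim (by omega)),
    census_of_isIsogenous_cmField_oneBalancedPlace (by rw [Fintype.card_fin]) hBs φ (by rw [hE6, Fintype.card_fin]) μ hinj
      hdist hmult (by rw [hB, Fintype.card_fin]) k₀ hk₀ hunb k₁ k₂ hk₁₂ hk₁ hk₂ hnW hAB⟩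

/-- **Row 12, CM pattern `(2,2,1)`, the model itself, under the displayed `hnW`**: `B` is in the nodes' domain and
satisfies X2-at-`B` ∧ X1-at-`B` (the case `A = B` of `census_row12_sextic_oneBalancedPlace`). HC ∕ HC_AV NOT proved.
[cite: MoonenZarhin1999LowDim, §1 (1.8) and §2 (2.3)] [cite: Ribet1983, Thm. 0] -/
theorem census_row12_sextic_oneBalancedPlace_self {B : AbelianVariety ℂ} (hB : B.dim = 6) (hBs : B.IsSimple) (φ : B ⟶ B)
    (hE6 : Module.finrank ℚ B.endAlgebra = 6) (μ : Fin 3 → ℂ) (hinj : Function.Injective μ)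
    (hdist : ∀ k k', μ k' ≠ starRingEnd ℂ (μ k))
    (hmult : ∀ k, eigenMultiplicity B φ (μ k) + eigenMultiplicity B φ (starRingEnd ℂ (μ k)) = 2) (k₀ : Fin 3)
    (hk₀ : eigenMultiplicity B φ (μ k₀) ≠ 0 ∧ eigenMultiplicity B φ (starRingEnd ℂ (μ k₀)) ≠ 0)
    (hunb : ∀ k, k ≠ k₀ → eigenMultiplicity B φ (μ k) = 0 ∨ eigenMultiplicity B φ (starRingEnd ℂ (μ k)) = 0)
    (k₁ k₂ : Fin 3) (hk₁₂ : k₁ ≠ k₂) (hk₁ : k₁ ≠ k₀) (hk₂ : k₂ ≠ k₀)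
    (hnW : ∀ (d : ℕ) (β : B ⟶ B), 0 < d → β ≫ β = -(d • 𝟙 B) →
      eigenMultiplicity B β (Complex.I * (Real.sqrt d : ℂ)) ≠ eigenMultiplicity B β (-(Complex.I * (Real.sqrt d : ℂ)))) :
    (B.dim = 6 ∧ ¬ (IsOfCMType B ∨ ProdCMCell IsQuarticFieldTypeIVFourfold (fun Z ↦ Z.dim = 2) B)) ∧
    (∀ c : complexBetti B.X (2 * 2), IsRationalClass c → IsOfHodgeType B.dim B.X (2 * 2) 2 2 c →
      c ∈ divisorClassesSpan B.X B.dim 2 ⊔ Submodule.span ℂ {w' : complexBetti B.X (2 * 2) |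
        ∃ (C : AbelianVariety ℂ) (g : B.X ⟶ C.X) (w : complexBetti C.X (2 * 2)), C.dim < B.dim ∧
          IsRationalClass w ∧ IsOfHodgeType C.dim C.X (2 * 2) 2 2 w ∧ w' = complexBetti.map g (2 * 2) w}) ∧
    (∀ c : complexBetti B.X (2 * 3), IsRationalClass c → IsOfHodgeType B.dim B.X (2 * 3) 3 3 c →
      c ∈ divisorClassesSpan B.X B.dim 3 ⊔ Submodule.span ℂ {w' : complexBetti B.X (2 * 3) |
          ∃ (a : complexBetti B.X (2 * 2)) (b : complexBetti B.X (2 * 1)),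
            IsRationalClass a ∧ IsOfHodgeType B.dim B.X (2 * 2) 2 2 a ∧ IsRationalClass b ∧
            IsOfHodgeType B.dim B.X (2 * 1) 1 1 b ∧ w' = cupProduct (two_mul_add_two_mul 2 1) a b} ⊔
        Submodule.span ℂ {w' : complexBetti B.X (2 * 3) |
          ∃ (C : AbelianVariety ℂ) (g : B.X ⟶ C.X) (w : complexBetti C.X (2 * 3)), C.dim < B.dim ∧
            IsRationalClass w ∧ IsOfHodgeType C.dim C.X (2 * 3) 3 3 w ∧ w' = complexBetti.map g (2 * 3) w} ⊔
        Submodule.span ℂ {w' : complexBetti B.X (2 * 3) |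
          ∃ (B' : AbelianVariety ℂ) (g : B.X ⟶ B'.X) (d : ℕ) (ψ : B' ⟶ B') (w : complexBetti B'.X (2 * 3)),
            B'.dim = 6 ∧ 0 < d ∧ ψ ≫ ψ = -(d • 𝟙 B') ∧ IsRationalClass w ∧
            IsOfHodgeType B'.dim B'.X (2 * 3) 3 3 w ∧ w ∈ weilClassesOf B' ψ 3 d ∧
            w' = complexBetti.map g (2 * 3) w}) :=
  census_row12_sextic_oneBalancedPlace hB hBs φ hE6 μ hinj hdist hmult k₀ hk₀ hunb k₁ k₂ hk₁₂ hk₁ hk₂ hnW (IsIsogenous.refl B)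

end Summit.HodgeConjecture.HodgeConjecture.TableX.TypeIVRows

end
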